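import Summits.QuantumAdvantage.QuantumAdvantage.Theorems.CharDialShearDialA
import Summits.QuantumAdvantage.QuantumAdvantage.Theorems.CharDialExchangeBridge
import Summits.QuantumAdvantage.AdviceFreeQNC0.SumCodeDegreeZero
import Literature.Computability.MetaComplexity.TwoModuliExpSums
import HarnessLib

/-!
# CharDial — the SYMMETRIC-BLOCK LAW (part A1): the dial, the finite kernel, transpositions

Tree twin, part A1 (§0–§2), of the decomp-qadv lens-5 g34 node `Theses/ColumnDial.lean`.  THE DIAL = the size of a SYMMETRIC BLOCK of a
strategy `y : Fin (n+1) → (Fin n → Bool) → Bool` for the mod-3 walk game `ringWinU`: a set `S` of input positions such that every cut's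
output is unchanged when the bits on `S` are modified with the number of ones on `S` preserved modulo `p` (bits off `S` fixed) —
`SymBlock p S y`, `HasSymBlock p m y` (§0).  THE LAW `SymBlockLaw` (proved in part B3, `symBlockLaw`): for every modulus `p ≥ 2` coprime to `3`
there is `m₀(p)` such that EVERY strategy (no degree hypothesis, every `n`, every charge `c`) with a symmetric block of size `≥ m₀(p)` wins on
at most `(6/7)·2ⁿ` inputs.  §1 the finite kernel: blind PHASE BELLS on `ℤ/3` of EVEN WEIGHT vanish or form a co-point (`phasePat_even`,
`evenPattern_cases`, `outer_bells_lose_somewhere`, `flip_iff_twoSet`); §2 transpositions of two block positions fix every output of a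
symmetric block and shift addresses coherently (`symBlock_swap`, `walkExp_comp_swap_out`).
Kernel-checked, no `sorry`, no instances, no notation.  Memo: decomp-qadv-lens-5/g34/NODE-g34.md (§9 proof map, §10 land package); blueprint BLUEPRINT-g34.md.  Re-cut of the staged part A (e9ab60e3) at section boundaries (≤ 400 lines per file, every declaration docstringed); declaration bodies byte-identical.
-/

set_option autoImplicit false
set_option linter.dupNamespace false

namespace Summit.QuantumAdvantage.QuantumAdvantage.Theorems.ColumnDial

open Finset
open Summit.QuantumAdvantage.AdviceFreeQNC0

/-! ### §0 The dial: symmetric blocks, and the statement of the law -/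

section Defs

variable {n : ℕ}

/-- `S` is a SYMMETRIC BLOCK (mod `p`) of the strategy `y`: changing the bits on `S` while keeping the bits off `S` and the weight on `S`
modulo `p` changes no cut's output. -/
def SymBlock (p : ℕ) (S : Finset (Fin n)) (y : Fin (n + 1) → (Fin n → Bool) → Bool) : Prop :=
  ∀ (g : Fin (n + 1)) (u v : Fin n → Bool), (∀ i, i ∉ S → u i = v i) →
    ((SubChar.bw S u : ℕ) : ZMod p) = ((SubChar.bw S v : ℕ) : ZMod p) → y g u = y g v

/-- the strategy has a symmetric block of size at least `m`. -/
def HasSymBlock (p m : ℕ) (y : Fin (n + 1) → (Fin n → Bool) → Bool) : Prop :=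
  ∃ S : Finset (Fin n), m ≤ S.card ∧ SymBlock p S y

end Defs

/-- **THE SYMMETRIC-BLOCK LAW** (finite kernel §1–§2, proof §3 and part B): for every modulus `p ≥ 2` coprime to `3`
there is a block size `m₀` such that every strategy with a symmetric block of size `≥ m₀` wins on at most `(6/7)·2ⁿ` inputs — every `n`,
every charge, NO degree hypothesis.  [★★ PROVED: `symBlockLaw`, part B] -/
def SymBlockLaw : Prop :=
  ∀ p : ℕ, 2 ≤ p → Nat.Coprime p 3 → ∃ m₀ : ℕ, ∀ (n c : ℕ) (y : Fin (n + 1) → (Fin n → Bool) → Bool),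
    HasSymBlock p m₀ y →
      ((univ.filter fun u : Fin n → Bool => ringWinU c y u = true).card : ℝ) ≤ (6 / 7 : ℝ) * (2 : ℝ) ^ n

/-! ### §1 The finite kernel of the law: blind phase-bells on `ℤ/3` have even weight -/

section Kernel

variable {α : Type*} [DecidableEq α]

/-- the PHASE PATTERN of a set `F` of fired cuts with offsets `e`: parity of the number of cuts on support when the common shift is `t`. -/
def phasePat (F : Finset α) (e : α → ZMod 3) (t : ZMod 3) : Bool :=
  Nat.bodd (F.filter fun g => e g + t ≠ 0).card

omit [DecidableEq α] in
/-- The phase pattern of the empty family of bells is `false`. -/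
theorem phasePat_empty (e : α → ZMod 3) (t : ZMod 3) : phasePat (∅ : Finset α) e t = false := by
  simp [phasePat]

/-- Inserting a bell `a ∉ F` toggles the phase pattern by the bit `decide (e a + t ≠ 0)`. -/
theorem phasePat_insert {F : Finset α} {a : α} (ha : a ∉ F) (e : α → ZMod 3) (t : ZMod 3) :
    phasePat (insert a F) e t = (phasePat F e t ^^ decide (e a + t ≠ 0)) := by
  unfold phasePat
  rw [Finset.filter_insert]
  by_cases h : e a + t ≠ 0
  · rw [if_pos h, Finset.card_insert_of_notMem (fun hm => ha (Finset.mem_filter.1 hm).1), Nat.bodd_succ, decide_eq_true h]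
    cases Nat.bodd _ <;> rfl
  · rw [if_neg h, decide_eq_false h]
    cases Nat.bodd _ <;> rfl

/-- one cut is on support for exactly two of the three shifts. -/
theorem single_even (x : ZMod 3) :
    (decide (x + 0 ≠ 0) ^^ (decide (x + 1 ≠ 0) ^^ decide (x + 2 ≠ 0))) = false := by
  revert x; decide

/-- ★ **even weight**: every phase pattern takes the value `true` an even number of times on `ℤ/3`. -/
theorem phasePat_even (F : Finset α) (e : α → ZMod 3) :
    (phasePat F e 0 ^^ (phasePat F e 1 ^^ phasePat F e 2)) = false := by
  induction F using Finset.induction_on with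
  | empty => simp [phasePat_empty]
  | insert a F ha ih =>
    rw [phasePat_insert ha, phasePat_insert ha, phasePat_insert ha]
    have h1 := single_even (e a)
    revert ih h1
    generalize phasePat F e 0 = b0; generalize phasePat F e 1 = b1; generalize phasePat F e 2 = b2
    generalize decide (e a + 0 ≠ 0) = d0; generalize decide (e a + 1 ≠ 0) = d1; generalize decide (e a + 2 ≠ 0) = d2
    cases b0 <;> cases b1 <;> cases b2 <;> cases d0 <;> cases d1 <;> cases d2 <;> decide

/-- ★ an even-weight Boolean pattern on `ℤ/3` is either identically `false` or the co-indicator of a single point `ρ`. -/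
theorem evenPattern_cases : ∀ H : ZMod 3 → Bool, (H 0 ^^ (H 1 ^^ H 2)) = false →
    (∀ t, H t = false) ∨ ∃ ρ, ∀ t, H t = decide (t ≠ ρ) := by
  decide

/-- the phase pattern of a fibre is `0` or `[· ≠ ρ]`. -/
theorem phasePat_cases (F : Finset α) (e : α → ZMod 3) :
    (∀ t, phasePat F e t = false) ∨ ∃ ρ, ∀ t, phasePat F e t = decide (t ≠ ρ) :=
  evenPattern_cases _ (phasePat_even F e)

/-- ★ CASE «no inner bell» : the two OUTER bells (block entirely after the cut: shift `ν`; block entirely before it: shift `2ν`) are even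
patterns, so some residue `ν₀` of the block weight mod `3` LOSES for the whole class. -/
theorem outer_bells_lose_somewhere : ∀ H₀ Hm : ZMod 3 → Bool, (H₀ 0 ^^ (H₀ 1 ^^ H₀ 2)) = false →
    (Hm 0 ^^ (Hm 1 ^^ Hm 2)) = false → ∃ ν : ZMod 3, (H₀ ν ^^ Hm (2 * ν)) = false := by
  decide

/-- ★ CASE «inner bell at block position a» : shifting the bell's argument by `s ≠ 0` (the coherent shift of §2) REVERSES a co-point
pattern exactly on a two-element set of arguments. -/
theorem flip_iff_twoSet : ∀ ρ t s : ZMod 3, s ≠ 0 →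
    ((decide (t + s ≠ ρ) ^^ decide (t ≠ ρ)) = true ↔ (t = ρ ∨ t + s = ρ)) := by
  decide

end Kernel

/-! ### §2 Symmetric blocks and transpositions: outputs fixed, addresses coherently shifted -/

section Swap

variable {n : ℕ}

/-- a transposition inside a symmetric block fixes every cut's output. -/
theorem symBlock_swap {p : ℕ} {S : Finset (Fin n)} {y : Fin (n + 1) → (Fin n → Bool) → Bool} (hS : SymBlock p S y)
    {i j : Fin n} (hi : i ∈ S) (hj : j ∈ S) (g : Fin (n + 1)) (u : Fin n → Bool) :
    y g (u ∘ Equiv.swap i j) = y g u := by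
  refine hS g _ u (fun k hk => ?_) (by rw [SubChar.bw_comp_swap hi hj])
  have hki : k ≠ i := fun h => hk (h ▸ hi)
  have hkj : k ≠ j := fun h => hk (h ▸ hj)
  show u (Equiv.swap i j k) = u k
  rw [Equiv.swap_apply_of_ne_of_ne hki hkj]

/-- the total weight is fixed by any transposition. -/
theorem wt_comp_swap (i j : Fin n) (u : Fin n → Bool) : wt (u ∘ Equiv.swap i j) = wt u :=
  SubChar.bw_comp_swap (A := univ) (mem_univ i) (mem_univ j) u

/-- the prefix weight is the block weight of an initial segment. -/
theorem wtPrefix_eq_bw (u : Fin n → Bool) (g : ℕ) :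
    wtPrefix u g = SubChar.bw (univ.filter fun k : Fin n => k.val < g) u := by
  unfold wtPrefix SubChar.bw
  rw [Finset.filter_filter]

/-- block weight when the transposition stays inside or outside the block. -/
theorem bw_comp_swap_of_iff {A : Finset (Fin n)} {i j : Fin n} (h : i ∈ A ↔ j ∈ A) (u : Fin n → Bool) :
    SubChar.bw A (u ∘ Equiv.swap i j) = SubChar.bw A u := by
  by_cases hi : i ∈ A
  · exact SubChar.bw_comp_swap hi (h.1 hi) u
  · have hj : j ∉ A := fun hj => hi (h.2 hj)
    unfold SubChar.bw
    congr 1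
    refine Finset.filter_congr fun k hk => ?_
    have hki : k ≠ i := fun e => hi (e ▸ hk)
    have hkj : k ≠ j := fun e => hj (e ▸ hk)
    show u (Equiv.swap i j k) = true ↔ u k = true
    rw [Equiv.swap_apply_of_ne_of_ne hki hkj]

/-- block weight when exactly the first transposed position is inside: the bit at `i` is traded for the bit at `j`. -/
theorem bw_comp_swap_of_mem_not_mem {A : Finset (Fin n)} {i j : Fin n} (hi : i ∈ A) (hj : j ∉ A) (u : Fin n → Bool) :
    SubChar.bw A (u ∘ Equiv.swap i j) + (if u i then 1 else 0) = SubChar.bw A u + (if u j then 1 else 0) := by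
  have hij : i ≠ j := fun e => hj (e ▸ hi)
  unfold SubChar.bw
  rw [← Finset.insert_erase hi, Finset.filter_insert, Finset.filter_insert]
  have hrest : ((A.erase i).filter fun k => (u ∘ Equiv.swap i j) k = true) = ((A.erase i).filter fun k => u k = true) := by
    refine Finset.filter_congr fun k hk => ?_
    have hki : k ≠ i := (Finset.mem_erase.1 hk).1
    have hkj : k ≠ j := fun e => hj (e ▸ (Finset.mem_erase.1 hk).2)
    show u (Equiv.swap i j k) = true ↔ u k = true
    rw [Equiv.swap_apply_of_ne_of_ne hki hkj]
  have hni : i ∉ (A.erase i).filter fun k => u k = true := fun hm => (Finset.mem_erase.1 (Finset.mem_filter.1 hm).1).1 rfl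
  have hni' : i ∉ (A.erase i).filter fun k => (u ∘ Equiv.swap i j) k = true :=
    fun hm => (Finset.mem_erase.1 (Finset.mem_filter.1 hm).1).1 rfl
  have hsw : (u ∘ Equiv.swap i j) i = u j := by show u (Equiv.swap i j i) = u j; rw [Equiv.swap_apply_left]
  rw [hsw, hrest]
  by_cases hui : u i = true <;> by_cases huj : u j = true
  · simp [hui, huj, Finset.card_insert_of_notMem hni]
  · simp [hui, huj, Finset.card_insert_of_notMem hni]
  · simp [hui, huj, Finset.card_insert_of_notMem hni]
  · simp [hui, huj]

/-- ★ COHERENT SHIFT, outside: a cut with both or neither transposed position before it keeps its address. -/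
theorem walkExp_comp_swap_out (i j : Fin n) (u : Fin n → Bool) {g : ℕ} (h : i.val < g ↔ j.val < g) :
    walkExp (u ∘ Equiv.swap i j) g = walkExp u g := by
  unfold walkExp
  rw [wt_comp_swap, wtPrefix_eq_bw, wtPrefix_eq_bw, bw_comp_swap_of_iff]
  simpa using h

end Swap

end Summit.QuantumAdvantage.QuantumAdvantage.Theorems.ColumnDial
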